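/-
Copyright (c) 2026. All rights reserved.
Released under Apache 2.0 license as described in the file LICENSE.
-/
import Summits.AtomisticToContinuum.Crystallization.Theorems.ChartedZeroExcessLayeredLatticeLiouvilleVM

/-!
# ChartedZeroExcessLayeredLatticeLiouville — part VN «WindowInverse II»: localised inverse bounds uniform in the window, and the admissible weight
  profiles (decomp-a2c-lens-2, g57; helper of stmt-AtomisticToContinuum-26636, leaf (LD′) `ModalLipschitzZ`; bricks (3) / (4b),
  critic rows 923 (iv) / 929 (b))

* VN.1 ★★ LOCALISED INVERSE BOUNDS: `((δ − Λ)·η m·‖d m‖)² ≤ Σ_{n ∈ W} (η n·‖blockApply B W d n‖)²` pointwise (`weighted_pointwise_sq`,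
  Cauchy–Schwarz on the tested form of VM `weighted_coercive`), and — by superposition over the Green columns of VM `window_exists` — the window-uniform estimate
  `‖d m‖ ≤ (δ − Λ)⁻¹·Σ_{n ∈ W} ‖blockApply B W d n‖ / ω(m − n)` for every field supported in `W` and every admissible weight profile `ω`
  (`window_inverse_bound`), packaged with the solve as `window_solve`: the `ℓ^∞ → ℓ^∞` control of the window inverses, uniform in the window,
  that (3) (exhaustion `W ↑ ℤ`) and (4b) consume;
* VN.2 ADMISSIBLE PROFILES: `|x − y| ≤ (ρ − 1)·y` for reals within a factor `ρ ≥ 1` of each other, whence the exponential profile `μ^{|k|}`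
  (banded blocks, `θ u = μ^u − 1`) and the polynomial profile `(1 + |k|/L)²` (blocks with summable second moments — the `ϱ`-uniform Lennard-Jones
  case, `θ u = (1 + u/L)² − 1`) are admissible.
-/

namespace Summit.AtomisticToContinuum.Crystallization.Theorems.ChartedZeroExcessLayeredLatticeLiouville

open Summit.AtomisticToContinuum.Crystallization.Theorems.ChartedPlanarOrderRigidityDoor (E3)
open Finset
open scoped InnerProductSpace RealInnerProductSpace BigOperators

noncomputable section WindowInverseII

variable {W : Finset ℤ} {B : ℤ → ℤ → (E3 →L[ℝ] E3)} {δ Λ : ℝ}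

/-! ### VN.1  Localised inverse bounds, uniform in the window -/

/-- ★ POINTWISE LOCALISATION: under the hypotheses of `weighted_coercive` with `Λ < δ`, every window value is controlled by the WEIGHTED `ℓ²(W)`-norm of
the window image: `((δ − Λ)·η m·‖d m‖)² ≤ Σ_{n ∈ W} (η n·‖blockApply B W d n‖)²` (Cauchy–Schwarz on the tested form). [this file, g57] -/
theorem weighted_pointwise_sq
    (hco : ∀ d : ℤ → E3, δ * ∑ m ∈ W, ‖d m‖ ^ 2 ≤ ∑ m ∈ W, ⟪d m, blockApply B W d m⟫_ℝ)
    {η : ℤ → ℝ} {θ : ℕ → ℝ} (hη : ∀ m, 0 < η m) (hθ : ∀ m n : ℤ, |η m - η n| ≤ θ (m - n).natAbs * η n)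
    (hrow : ∀ m ∈ W, ∑ n ∈ W, θ (m - n).natAbs * ‖B m n‖ ≤ Λ) (hcol : ∀ n ∈ W, ∑ m ∈ W, θ (m - n).natAbs * ‖B m n‖ ≤ Λ)
    (hΛ : Λ < δ) (d : ℤ → E3) {m : ℤ} (hm : m ∈ W) :
    ((δ - Λ) * (η m * ‖d m‖)) ^ 2 ≤ ∑ n ∈ W, (η n * ‖blockApply B W d n‖) ^ 2 := by
  have hW := weighted_coercive hco hη hθ hrow hcol d
  set A := ∑ n ∈ W, (η n * ‖d n‖) ^ 2 with hAdef
  set G := ∑ n ∈ W, (η n * ‖blockApply B W d n‖) ^ 2 with hGdef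
  set P := ∑ n ∈ W, (η n * ‖d n‖) * (η n * ‖blockApply B W d n‖) with hPdef
  have hSP : ∑ n ∈ W, η n ^ 2 * ⟪d n, blockApply B W d n⟫_ℝ ≤ P := by
    refine sum_le_sum fun n _ => ?_
    have := real_inner_le_norm (d n) (blockApply B W d n)
    have hη2 : 0 ≤ η n ^ 2 := sq_nonneg _
    nlinarith
  have hx : (η m * ‖d m‖) ^ 2 ≤ A := single_le_sum (f := fun n => (η n * ‖d n‖) ^ 2) (fun n _ => sq_nonneg _) hm
  have hP : (δ - Λ) * A ≤ P := hW.trans hSP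
  have hP2 : P ^ 2 ≤ A * G := sum_mul_sq_le_sq_mul_sq W _ _
  have hδΛ : 0 ≤ δ - Λ := (sub_pos.mpr hΛ).le
  have hA0 : 0 ≤ A := sum_nonneg fun n _ => sq_nonneg _
  have hG0 : 0 ≤ G := sum_nonneg fun n _ => sq_nonneg _
  by_cases hA : A = 0
  · have hzero : (η m * ‖d m‖) ^ 2 = 0 := le_antisymm (hA ▸ hx) (sq_nonneg _)
    rw [mul_pow, hzero, mul_zero]
    exact hG0
  · have hApos : 0 < A := lt_of_le_of_ne hA0 (Ne.symm hA)
    have h1 : ((δ - Λ) * A) ^ 2 ≤ A * G := (pow_le_pow_left₀ (mul_nonneg hδΛ hA0) hP 2).trans hP2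
    have h2 : (δ - Λ) ^ 2 * A ≤ G := by
      have : A * ((δ - Λ) ^ 2 * A) ≤ A * G := by
        calc A * ((δ - Λ) ^ 2 * A) = ((δ - Λ) * A) ^ 2 := by ring
          _ ≤ A * G := h1
      exact le_of_mul_le_mul_left this hApos
    calc ((δ - Λ) * (η m * ‖d m‖)) ^ 2 = (δ - Λ) ^ 2 * (η m * ‖d m‖) ^ 2 := by ring
      _ ≤ (δ - Λ) ^ 2 * A := mul_le_mul_of_nonneg_left hx (sq_nonneg _)
      _ ≤ G := h2

/-- ★★ WINDOW INVERSE BOUND, uniform in the window.  For a `δ`-coercive block family and an admissible weight PROFILE `ω` (`ω > 0`, `ω 0 = 1`,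
`|ω m − ω n| ≤ θ(|m−n|)·ω n`, weighted row / column sums `≤ Λ < δ`), every field `d` supported in `W` obeys
`‖d m‖ ≤ (δ − Λ)⁻¹ · Σ_{n ∈ W} ‖blockApply B W d n‖ / ω(m − n)` on `W`: superposition of the Green columns of `window_exists`, each localised by
`weighted_pointwise_sq` with the profile centred at its source.  With `ω` growing (exponentially for banded blocks, polynomially for polynomially
decaying ones) this is the `ℓ^∞ → ℓ^∞` bound on the window inverses with constants independent of `W`. [this file, g57] -/
theorem window_inverse_bound (hδ : 0 < δ)
    (hco : ∀ d : ℤ → E3, δ * ∑ m ∈ W, ‖d m‖ ^ 2 ≤ ∑ m ∈ W, ⟪d m, blockApply B W d m⟫_ℝ)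
    {ω : ℤ → ℝ} {θ : ℕ → ℝ} (hω : ∀ k, 0 < ω k) (hω0 : ω 0 = 1) (hθ : ∀ m n : ℤ, |ω m - ω n| ≤ θ (m - n).natAbs * ω n)
    (hrow : ∀ m ∈ W, ∑ n ∈ W, θ (m - n).natAbs * ‖B m n‖ ≤ Λ) (hcol : ∀ n ∈ W, ∑ m ∈ W, θ (m - n).natAbs * ‖B m n‖ ≤ Λ)
    (hΛ : Λ < δ) {d : ℤ → E3} (hd : ∀ m, m ∉ W → d m = 0) {m : ℤ} (hm : m ∈ W) :
    ‖d m‖ ≤ (δ - Λ)⁻¹ * ∑ n ∈ W, (ω (m - n))⁻¹ * ‖blockApply B W d n‖ := by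
  have hex : ∀ n : ℤ, ∃ e : ℤ → E3, (∀ k, k ∉ W → e k = 0) ∧
      ∀ k ∈ W, blockApply B W e k = if k = n then blockApply B W d n else 0 :=
    fun n => window_exists hδ hco _
  choose e he0 he using hex
  have hsum : d = ∑ n ∈ W, e n := by
    refine window_unique hδ hco hd (fun k hk => ?_) (fun k hk => ?_)
    · rw [Finset.sum_apply]
      exact sum_eq_zero fun n _ => he0 n k hk
    · rw [blockApply_sum, sum_congr rfl fun n _ => he n k hk, sum_ite_eq, if_pos hk]
  have hcolumn : ∀ n ∈ W, ‖e n m‖ ≤ (δ - Λ)⁻¹ * ((ω (m - n))⁻¹ * ‖blockApply B W d n‖) := by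
    intro n hn
    have hθ' : ∀ k l : ℤ, |ω (k - n) - ω (l - n)| ≤ θ (k - l).natAbs * ω (l - n) := fun k l => by
      have := hθ (k - n) (l - n)
      rwa [show k - n - (l - n) = k - l by ring] at this
    have hpt := weighted_pointwise_sq hco (η := fun k => ω (k - n)) (fun k => hω _) hθ' hrow hcol hΛ (e n) hm
    have hG : ∑ k ∈ W, (ω (k - n) * ‖blockApply B W (e n) k‖) ^ 2 = ‖blockApply B W d n‖ ^ 2 := by
      have hk : ∀ k ∈ W, (ω (k - n) * ‖blockApply B W (e n) k‖) ^ 2 = if n = k then ‖blockApply B W d n‖ ^ 2 else 0 := by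
        intro k hk
        rw [he n k hk]
        by_cases hkn : k = n
        · subst hkn
          rw [if_pos rfl, if_pos rfl, sub_self, hω0, one_mul]
        · rw [if_neg hkn, if_neg (Ne.symm hkn), norm_zero, mul_zero, zero_pow two_ne_zero]
      rw [sum_congr rfl hk, sum_ite_eq, if_pos hn]
    rw [hG] at hpt
    have hnn : 0 ≤ (δ - Λ) * (ω (m - n) * ‖e n m‖) := mul_nonneg (sub_pos.mpr hΛ).le (mul_nonneg (hω _).le (norm_nonneg _))
    have hle : (δ - Λ) * (ω (m - n) * ‖e n m‖) ≤ ‖blockApply B W d n‖ := le_of_pow_le_pow_left₀ two_ne_zero (norm_nonneg _) hpt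
    have hδΛ : (δ - Λ) ≠ 0 := (sub_pos.mpr hΛ).ne'
    have hωn : ω (m - n) ≠ 0 := (hω _).ne'
    calc ‖e n m‖ = ((δ - Λ)⁻¹ * (ω (m - n))⁻¹) * ((δ - Λ) * (ω (m - n) * ‖e n m‖)) := by
          field_simp
      _ ≤ ((δ - Λ)⁻¹ * (ω (m - n))⁻¹) * ‖blockApply B W d n‖ :=
          mul_le_mul_of_nonneg_left hle (mul_nonneg (inv_nonneg.mpr (sub_pos.mpr hΛ).le) (inv_nonneg.mpr (hω _).le))
      _ = (δ - Λ)⁻¹ * ((ω (m - n))⁻¹ * ‖blockApply B W d n‖) := by ring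
  calc ‖d m‖ = ‖(∑ n ∈ W, e n) m‖ := by rw [← hsum]
    _ = ‖∑ n ∈ W, e n m‖ := by rw [Finset.sum_apply]
    _ ≤ ∑ n ∈ W, ‖e n m‖ := norm_sum_le _ _
    _ ≤ ∑ n ∈ W, (δ - Λ)⁻¹ * ((ω (m - n))⁻¹ * ‖blockApply B W d n‖) := sum_le_sum hcolumn
    _ = (δ - Λ)⁻¹ * ∑ n ∈ W, (ω (m - n))⁻¹ * ‖blockApply B W d n‖ := by rw [← mul_sum]

/-- ★★ THE WINDOW SOLVE WITH ITS UNIFORM BOUND: under `δ`-coercivity on `W` and an admissible weight profile (as in `window_inverse_bound`), every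
right-hand side `h` has a unique solution `d` supported in `W` of `blockApply B W d = h` on `W`, and `‖d m‖ ≤ (δ − Λ)⁻¹ · Σ_{n ∈ W} ‖h n‖ / ω(m − n)`
— in particular `‖d‖_∞ ≤ (δ − Λ)⁻¹·(Σ_k ω(k)⁻¹)·‖h‖_∞` whenever `ω⁻¹` is summable, with no dependence on the window. [this file, g57] -/
theorem window_solve (hδ : 0 < δ)
    (hco : ∀ d : ℤ → E3, δ * ∑ m ∈ W, ‖d m‖ ^ 2 ≤ ∑ m ∈ W, ⟪d m, blockApply B W d m⟫_ℝ)
    {ω : ℤ → ℝ} {θ : ℕ → ℝ} (hω : ∀ k, 0 < ω k) (hω0 : ω 0 = 1) (hθ : ∀ m n : ℤ, |ω m - ω n| ≤ θ (m - n).natAbs * ω n)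
    (hrow : ∀ m ∈ W, ∑ n ∈ W, θ (m - n).natAbs * ‖B m n‖ ≤ Λ) (hcol : ∀ n ∈ W, ∑ m ∈ W, θ (m - n).natAbs * ‖B m n‖ ≤ Λ)
    (hΛ : Λ < δ) (h : ℤ → E3) :
    ∃ d : ℤ → E3, (∀ m, m ∉ W → d m = 0) ∧ (∀ m ∈ W, blockApply B W d m = h m) ∧
      ∀ m ∈ W, ‖d m‖ ≤ (δ - Λ)⁻¹ * ∑ n ∈ W, (ω (m - n))⁻¹ * ‖h n‖ := by
  obtain ⟨d, hd, hdh⟩ := window_exists hδ hco h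
  refine ⟨d, hd, hdh, fun m hm => ?_⟩
  have := window_inverse_bound hδ hco hω hω0 hθ hrow hcol hΛ hd hm
  rwa [sum_congr rfl fun n hn => by rw [hdh n hn]] at this

/-! ### VN.2  Admissible weight profiles: exponential (banded blocks) and polynomial (`ϱ`-uniform polynomial decay) -/

/-- two reals within a factor `ρ ≥ 1` of each other differ by at most `(ρ − 1)` times the second. [formal bookkeeping] -/
theorem abs_sub_le_of_le_mul {x y ρ : ℝ} (hρ : 1 ≤ ρ) (hxy : x ≤ ρ * y) (hyx : y ≤ ρ * x) :
    |x - y| ≤ (ρ - 1) * y := by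
  rcases le_or_gt y x with h | h
  · rw [abs_of_nonneg (sub_nonneg.mpr h)]
    linarith
  · rw [abs_of_neg (sub_neg.mpr h)]
    nlinarith [mul_nonneg (sub_nonneg.mpr hρ) (sub_nonneg.mpr h.le)]

/-- ★ the EXPONENTIAL PROFILE `ω k = μ^{|k|}` (`μ ≥ 1`) is admissible with `θ u = μ^u − 1` — the choice for BANDED blocks (`θ` vanishes nowhere but the
weighted row sums of a band-`r` family are `≤ (μ^r − 1)·(2r+1)·sup ‖B m n‖`, small for `μ` near `1`). [this file, g57] -/
theorem expProfile_admissible {μ : ℝ} (hμ : 1 ≤ μ) (m n : ℤ) :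
    |μ ^ m.natAbs - μ ^ n.natAbs| ≤ (μ ^ (m - n).natAbs - 1) * μ ^ n.natAbs := by
  refine abs_sub_le_of_le_mul (one_le_pow₀ hμ) ?_ ?_
  · rw [← pow_add]
    exact pow_le_pow_right₀ hμ (by omega)
  · rw [← pow_add]
    exact pow_le_pow_right₀ hμ (by omega)

/-- the elementary sub-multiplicativity behind the polynomial profile: `1 + |m|/L ≤ (1 + |m − n|/L)(1 + |n|/L)`. [formal bookkeeping] -/
theorem one_add_natAbs_div_le {L : ℝ} (hL : 0 < L) (m n : ℤ) :
    1 + (m.natAbs : ℝ) / L ≤ (1 + ((m - n).natAbs : ℝ) / L) * (1 + (n.natAbs : ℝ) / L) := by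
  have h1 : (m.natAbs : ℝ) ≤ ((m - n).natAbs : ℝ) + n.natAbs := by
    exact_mod_cast (show m.natAbs ≤ (m - n).natAbs + n.natAbs by omega)
  have hexp : (1 + ((m - n).natAbs : ℝ) / L) * (1 + (n.natAbs : ℝ) / L) =
      1 + (((m - n).natAbs : ℝ) + n.natAbs) / L + ((m - n).natAbs : ℝ) * n.natAbs / L ^ 2 := by
    field_simp
    ring
  rw [hexp]
  have h2 : 0 ≤ ((m - n).natAbs : ℝ) * n.natAbs / L ^ 2 := by positivity
  have h3 : (m.natAbs : ℝ) / L ≤ (((m - n).natAbs : ℝ) + n.natAbs) / L := div_le_div_of_nonneg_right h1 hL.le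
  linarith

/-- ★ the POLYNOMIAL PROFILE `ω k = (1 + |k|/L)²` (`L > 0`) is admissible with `θ u = (1 + u/L)² − 1 ≤ 3u/L` for `u ≤ L` — the choice for blocks with
summable second moments `Σ_n (1 + |m − n|)²‖B m n‖ < ∞` (the Lennard-Jones flux operator, uniformly in the truncation `ϱ`): the weighted row sums are
`O(1/L)`, small for a long profile, while `Σ_k ω(k)⁻¹ ≤ 1 + 2L` stays finite. [this file, g57] -/
theorem polyProfile_admissible {L : ℝ} (hL : 0 < L) (m n : ℤ) :
    |(1 + (m.natAbs : ℝ) / L) ^ 2 - (1 + (n.natAbs : ℝ) / L) ^ 2| ≤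
      ((1 + ((m - n).natAbs : ℝ) / L) ^ 2 - 1) * (1 + (n.natAbs : ℝ) / L) ^ 2 := by
  have hpos : ∀ k : ℤ, 0 < 1 + (k.natAbs : ℝ) / L := fun k => by positivity
  refine abs_sub_le_of_le_mul (one_le_pow₀ (le_add_of_nonneg_right (by positivity))) ?_ ?_
  · rw [← mul_pow]
    exact pow_le_pow_left₀ (hpos m).le (one_add_natAbs_div_le hL m n) 2
  · rw [← mul_pow]
    refine pow_le_pow_left₀ (hpos n).le ?_ 2
    have := one_add_natAbs_div_le hL n m
    rwa [show (n - m).natAbs = (m - n).natAbs by omega] at this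

end WindowInverseII

end Summit.AtomisticToContinuum.Crystallization.Theorems.ChartedZeroExcessLayeredLatticeLiouville
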